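import Mathlib
import Summits.Ventures.PercRepro2.GcTransport
import Summits.Ventures.PercRepro2.A3Reduction
import Summits.Ventures.PercRepro2.A3LeafQuadratic

/-!
# (a₃-RECM) at a LEAF a₃-edge from the one inequality `c₂ ≤ c₀` (blind cell PercRepro2, mine-2 g16;
proofs/MINE2-A3FIRST.md §7–§8)

* **`Gc_update_one_eq_contract_a3`**: pinned open = contracted at an `a₃`-edge `e = {a₃, y}` with `y`
  unmarked — `Gc(p[e ↦ 1]) = Gc(G/e)`, `G/e = contractRootEdge ends a₃ y` (the `a₃`-variant of
  `GcTransport.Gc_update_one_eq_contract`, same transport, the marks `o, a₁, a₂, b` fixed).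
* **`A3RECMAt_of_leaf`**: at a leaf `a₃`-edge `f = {a₃, y}` (the only edge at `a₃`) with `y` unmarked
  and `0 ≤ p f ≤ 1`, `A3RECM.A3RECMAt` — `p f · Gc(G/f) ≤ Gc(G)` — follows from `0 ≤ Gc(p[f ↦ 0])`
  (HCOV on the deleted graph, the induction hypothesis of `A3Reduction`) and the single inequality
  `A3Leaf.c2 ≤ Gc(p[f ↦ 0])` (`A3Leaf.leaf_step`).
-/

namespace Summit.Ventures.PercRepro2

open UnionCluster CovForm Contract RECM

namespace A3Leaf

variable {V : Type*} {E : Type*} [Fintype E] [DecidableEq E] [DecidableEq V]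
  {R : Type*} [Field R] [LinearOrder R]

omit [LinearOrder R] in
/-- **Pinned open = contracted at an `a₃`-edge**: `Gc(p[e ↦ 1]) = Gc(G/e)` for `e = {a₃, y}`, `y` unmarked. -/
theorem Gc_update_one_eq_contract_a3 (p : E → R) {ends : E → Sym2 V} {e : E} {o a₁ a₂ a₃ b y : V}
    (hg : ends e = s(a₃, y)) (hy : Unmarked o a₁ a₂ a₃ b y) (h3o : a₃ ≠ o) (h31 : a₃ ≠ a₁)
    (h32 : a₃ ≠ a₂) (h3b : a₃ ≠ b) :
    Gc (Function.update p e 1) ends o a₁ a₂ a₃ b =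
      Gc p (contractRootEdge ends a₃ y) o a₁ a₂ a₃ b := by
  have key := Gc_transport (φ := contractMap {a₃, y} a₃) (prob_update_one_eq_preimage p e)
    (fun ω x z => conn_update_true_iff_contract hg ω x z) o a₁ a₂ a₃ b
  obtain ⟨hyo, hy1, hy2, hy3, hyb⟩ := hy
  have ho : o ∉ ({a₃, y} : Finset V) := by simp [h3o.symm, hyo.symm]
  have h1 : a₁ ∉ ({a₃, y} : Finset V) := by simp [h31.symm, hy1.symm]
  have h2 : a₂ ∉ ({a₃, y} : Finset V) := by simp [h32.symm, hy2.symm]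
  have hb : b ∉ ({a₃, y} : Finset V) := by simp [h3b.symm, hyb.symm]
  rwa [contractMap_of_notMem ho, contractMap_of_notMem h1, contractMap_of_notMem h2,
    contractMap_of_mem (Finset.mem_insert_self a₃ {y}), contractMap_of_notMem hb] at key

variable [IsStrictOrderedRing R]

/-- **(a₃-RECM) at a leaf `a₃`-edge** from (HCOV) on the deleted graph and `c₂ ≤ Gc(p[f ↦ 0])`. -/
theorem A3RECMAt_of_leaf (p : E → R) {ends : E → Sym2 V} {f : E} {o a₁ a₂ a₃ b y : V}
    (hf : ends f = s(a₃, y)) (hleaf : ∀ e, a₃ ∈ ends e → e = f) (hy : Unmarked o a₁ a₂ a₃ b y)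
    (h3o : a₃ ≠ o) (h31 : a₃ ≠ a₁) (h32 : a₃ ≠ a₂) (h3b : a₃ ≠ b) (ht0 : 0 ≤ p f) (ht1 : p f ≤ 1)
    (h0 : 0 ≤ Gc (Function.update p f 0) ends o a₁ a₂ a₃ b)
    (hc : c2 p ends f o a₁ a₂ a₃ b ≤ Gc (Function.update p f 0) ends o a₁ a₂ a₃ b) :
    A3RECM.A3RECMAt p ends o a₁ a₂ a₃ b f y := by
  unfold A3RECM.A3RECMAt
  rw [← Gc_update_one_eq_contract_a3 p hf hy h3o h31 h32 h3b]
  exact leaf_step p hf hleaf hy.2.2.2.1.symm h31 h32 h3o h3b ht0 ht1 h0 hc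

end A3Leaf

end Summit.Ventures.PercRepro2
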